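import Summits.AtomisticToContinuum.FouriersLaw.Theorems.VanishingNoiseTransferNoisyFourierThomsonWitnessCostsLiouvillianAux1
import Summits.AtomisticToContinuum.FouriersLaw.Theorems.VanishingNoiseTransferNoisyFourierThomsonWitnessMoments
import Summits.AtomisticToContinuum.FouriersLaw.Theorems.VanishingNoiseTransferNoisyFourierThomsonWitnessParityAux2

/-!
# Costs of the Thomson witness, Liouvillian part, II: the local size and the bond blocks as functions
(`--supports` file for crux `VanishingNoiseTransfer.NoisyFourier`, stmt-AtomisticToContinuum-11977, line
`abel-storage-decay`, stub B `stub_bulkAbelGKPositivity`; part W5b "WitnessL2Liouvillian" of lead c7's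
Thomson-witness project, file 2 of 3)

Setting as in file I (`…CostsLiouvillianAux1`): `P = pinnedChain ω₂ lam β γ`, `μ_T = P.gibbsMeasure L T`, the blocks
`R_A`, `R_B` of the Liouvillian of the Thomson witness on a bond `(i, j = i + 1)` (written out; no definitions).
* The LOCAL SIZE of the window of (at most five) sites around `c`, `m_c(x) = 1 + Σ_{|k − c| ≤ 2} (p_k² + q_k²)`:
  `one_le_localSize`, `sq_le_localSize`, `localSize_le` (`m_c ≤ (3 + 2/ω₂)(1 + H)`), and its `L`-UNIFORM moments
  `exists_integral_localSize_pow_le` (`∫ m_c^n dμ_T ≤ C(n)` for all `L`, `c`, from the uniform one-site moments of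
  part W4 `…ThomsonWitnessMoments`).
* The site-indexed bond functions `f^A_i = Σ_{j = i+1} p_i R_A^{(i,j)}`, `f^B_j = Σ_{j = i+1} p_j R_B^{(i,j)}`:
  dependence on the momenta (`bondRA_congr`, `bondRB_congr`), smoothness (`contDiff_bondRA/RB`, `continuous_fA/fB`),
  the pointwise bounds `(f^A_i)² ≤ K m_i⁵`, `(f^B_j)² ≤ K m_j⁵` (`fA_sq_le`, `fB_sq_le`, from file I), and their
  momentum-flip parities (`fA_momentumFlip_of_ne/_self`, `fB_momentumFlip_of_ne/_self`: `f^A_i` is odd under `F_i`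
  and even under `F_m` for `m ∉ {i, i+1, i+2}`; `f^B_j` is odd under `F_j` and even under `F_m`, `m ∉ {j, j−1, j−2}`).
* Registered helper `helper_thomsonWitnessLocalSizeMoments`.
All statements are [folklore]; no definitions; axioms `propext`, `Classical.choice`, `Quot.sound` only.
-/

noncomputable section

open MeasureTheory
open scoped BigOperators ContDiff
open Literature.MathematicalPhysics.KineticTheory.HeatConduction
open Summit.AtomisticToContinuum.FouriersLaw.Cruxes.SuperadditiveResistance.InsertionToolbox
  (pinnedChain_integrable_of_abs_le contDiff_snd_apply)
open Summit.AtomisticToContinuum.FouriersLaw.Theorems.NoisyFourier.ThomsonWitness.Moments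
  (integrable_fst_pow integrable_snd_pow exists_integral_fst_even_pow_le integral_snd_even_pow_le)
open Summit.AtomisticToContinuum.FouriersLaw.Theorems.NoisyFourier.ThomsonWitness.Parity (card_band_le)
open Summit.AtomisticToContinuum.FouriersLaw.Theorems.NoisyFourier.ThomsonWitness.Algebra
  (partialQ_hamiltonian partialQ_partialQ_hamiltonian contDiff_partialQ_hamiltonian contDiff_phi_coord
    contDiff_dphi_coord contDiff_ddphi_coord contDiff_fst_apply)

namespace Summit.AtomisticToContinuum.FouriersLaw.Theorems.NoisyFourier.ThomsonWitness.Costs.Xv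

variable {L : ℕ} {ω₂ lam β γ : ℝ}

/-! ### The local size of a window of five sites -/

/-- `1 ≤ m_c(x) = 1 + Σ_{|k − c| ≤ 2} (p_k² + q_k²)`. [folklore] -/
theorem one_le_localSize (c : Fin L) (x : PhaseSpace L) :
    1 ≤ (1 + ∑ k ∈ Finset.univ.filter (fun k : Fin L => c.val ≤ k.val + 2 ∧ k.val ≤ c.val + 2), (x.2 k ^ 2 + x.1 k ^ 2)) :=
  le_add_of_nonneg_right (Finset.sum_nonneg fun k _ => by positivity)

/-- The local size dominates the squares of the coordinates of the window. [folklore] -/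
theorem sq_le_localSize {c k : Fin L} (hk : c.val ≤ k.val + 2 ∧ k.val ≤ c.val + 2) (x : PhaseSpace L) :
    x.2 k ^ 2 ≤ (1 + ∑ k ∈ Finset.univ.filter (fun k : Fin L => c.val ≤ k.val + 2 ∧ k.val ≤ c.val + 2), (x.2 k ^ 2 + x.1 k ^ 2)) ∧
      x.1 k ^ 2 ≤ (1 + ∑ k ∈ Finset.univ.filter (fun k : Fin L => c.val ≤ k.val + 2 ∧ k.val ≤ c.val + 2), (x.2 k ^ 2 + x.1 k ^ 2)) := by
  have hmem : k ∈ Finset.univ.filter (fun k : Fin L => c.val ≤ k.val + 2 ∧ k.val ≤ c.val + 2) :=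
    Finset.mem_filter.2 ⟨Finset.mem_univ _, hk⟩
  have h := Finset.single_le_sum (f := fun k : Fin L => x.2 k ^ 2 + x.1 k ^ 2) (fun k _ => by positivity) hmem
  have h1 := sq_nonneg (x.1 k)
  have h2 := sq_nonneg (x.2 k)
  constructor <;> linarith

/-- The local size is dominated by the energy: `m_c ≤ (3 + 2/ω₂)(1 + H)` (`Σ p²/2 + Σ ω₂ q²/2 ≤ H`). [folklore] -/
theorem localSize_le (hω : 0 < ω₂) (hl : 0 ≤ lam) (hβ : 0 ≤ β) (c : Fin L) (x : PhaseSpace L) :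
    (1 + ∑ k ∈ Finset.univ.filter (fun k : Fin L => c.val ≤ k.val + 2 ∧ k.val ≤ c.val + 2), (x.2 k ^ 2 + x.1 k ^ 2)) ≤
      (3 + 2 * ω₂⁻¹) * (1 + (pinnedChain ω₂ lam β γ).hamiltonian L x) := by
  have h := pinnedChain_harmonic_le_hamiltonian (ω₂ := ω₂) hl hβ γ L x
  have hsub : ∑ k ∈ Finset.univ.filter (fun k : Fin L => c.val ≤ k.val + 2 ∧ k.val ≤ c.val + 2),
      (x.2 k ^ 2 + x.1 k ^ 2) ≤ (∑ k, x.2 k ^ 2) + ∑ k, x.1 k ^ 2 := by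
    rw [← Finset.sum_add_distrib]
    exact Finset.sum_le_univ_sum_of_nonneg fun k => by positivity
  have hH := pinnedChain_hamiltonian_nonneg hω.le hl hβ γ L x
  have hp : ∑ k, x.2 k ^ 2 = 2 * ∑ k, x.2 k ^ 2 / 2 := by
    rw [Finset.mul_sum]
    exact Finset.sum_congr rfl fun k _ => by ring
  have hq : ∑ k, x.1 k ^ 2 = 2 * ω₂⁻¹ * ∑ k, ω₂ * x.1 k ^ 2 / 2 := by
    rw [Finset.mul_sum]
    refine Finset.sum_congr rfl fun k _ => ?_
    field_simp
  have h0p : 0 ≤ ∑ k, x.2 k ^ 2 / 2 := Finset.sum_nonneg fun k _ => by positivity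
  have h0q : 0 ≤ ∑ k, ω₂ * x.1 k ^ 2 / 2 := Finset.sum_nonneg fun k _ => by positivity
  have h1 : ∑ k, x.2 k ^ 2 ≤ 2 * (pinnedChain ω₂ lam β γ).hamiltonian L x := by
    rw [hp]; nlinarith
  have h2 : ∑ k, x.1 k ^ 2 ≤ 2 * ω₂⁻¹ * (pinnedChain ω₂ lam β γ).hamiltonian L x := by
    rw [hq]; exact mul_le_mul_of_nonneg_left (by linarith) (by positivity)
  have hω' : 0 ≤ ω₂⁻¹ := by positivity
  nlinarith [mul_nonneg hω' hH]

/-- The local size is continuous. [folklore] -/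
theorem continuous_localSize (c : Fin L) :
    Continuous fun x : PhaseSpace L => (1 + ∑ k ∈ Finset.univ.filter (fun k : Fin L => c.val ≤ k.val + 2 ∧ k.val ≤ c.val + 2), (x.2 k ^ 2 + x.1 k ^ 2)) :=
  continuous_const.add (continuous_finsetSum _ fun k _ => by fun_prop)

section Gibbs

variable (hω : 0 < ω₂) (hl : 0 ≤ lam) (hβ : 0 ≤ β) (γ : ℝ) {T : ℝ} (hT : 0 < T)
include hω hl hβ hT

/-- **`L`-uniform moments of the local size**: for every `n` there is `C = C(ω₂, lam, β, T, n)` with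
`m_c^n ∈ L¹(μ_T)` and `∫ m_c^n dμ_T ≤ C` for every length `L` and centre `c` (power means onto the at most five sites
of the window, then the uniform one-site even moments of part W4). [folklore] -/
theorem exists_integral_localSize_pow_le (n : ℕ) : ∃ C : ℝ, ∀ (L : ℕ) (c : Fin L),
    Integrable (fun x : PhaseSpace L => (1 + ∑ k ∈ Finset.univ.filter (fun k : Fin L => c.val ≤ k.val + 2 ∧ k.val ≤ c.val + 2), (x.2 k ^ 2 + x.1 k ^ 2)) ^ n)
        ((pinnedChain ω₂ lam β γ).gibbsMeasure L T) ∧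
      ∫ x, (1 + ∑ k ∈ Finset.univ.filter (fun k : Fin L => c.val ≤ k.val + 2 ∧ k.val ≤ c.val + 2), (x.2 k ^ 2 + x.1 k ^ 2)) ^ n
        ∂((pinnedChain ω₂ lam β γ).gibbsMeasure L T) ≤ C := by
  have hint : ∀ (n : ℕ) (L : ℕ) (c : Fin L), Integrable (fun x : PhaseSpace L =>
      (1 + ∑ k ∈ Finset.univ.filter (fun k : Fin L => c.val ≤ k.val + 2 ∧ k.val ≤ c.val + 2), (x.2 k ^ 2 + x.1 k ^ 2)) ^ n)
        ((pinnedChain ω₂ lam β γ).gibbsMeasure L T) := by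
    intro n L c
    refine pinnedChain_integrable_of_abs_le hω hl hβ γ L hT ((continuous_localSize c).pow n)
      (C := (3 + 2 * ω₂⁻¹) ^ n) (k := n) fun x => ?_
    have h1 := one_le_localSize c x
    rw [abs_of_nonneg (pow_nonneg (by linarith) n), ← mul_pow]
    exact pow_le_pow_left₀ (by linarith) (localSize_le hω hl hβ c x) n
  cases n with
  | zero =>
    refine ⟨1, fun L c => ⟨hint 0 L c, ?_⟩⟩
    haveI := pinnedChain_isProbabilityMeasure_gibbsMeasure hω hl hβ γ L hT
    simp
  | succ n =>
    obtain ⟨Cq, hCq0, hCq⟩ := exists_integral_fst_even_pow_le hω hl hβ γ hT (n + 1)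
    set Cp : ℝ := ((2 * (n + 1)).factorial : ℝ) * T ^ (n + 1) with hCp
    refine ⟨(2 : ℝ) ^ n + ((2 : ℝ) ^ n * ((5 : ℝ) ^ n * (2 : ℝ) ^ n)) * (5 * (Cp + Cq)), fun L c => ⟨hint _ L c, ?_⟩⟩
    haveI := pinnedChain_isProbabilityMeasure_gibbsMeasure hω hl hβ γ L hT
    have hcard : ((Finset.univ.filter (fun k : Fin L => c.val ≤ k.val + 2 ∧ k.val ≤ c.val + 2)).card : ℝ) ≤ 5 := by
      have h := card_band_le 2 c.val (fun k : Fin L => c.val ≤ k.val + 2 ∧ k.val ≤ c.val + 2) fun k hk => by omega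
      norm_num at h
      exact_mod_cast h
    set S := Finset.univ.filter (fun k : Fin L => c.val ≤ k.val + 2 ∧ k.val ≤ c.val + 2) with hS
    set G : PhaseSpace L → ℝ := fun x => ∑ k ∈ S, (x.2 k ^ (2 * (n + 1)) + x.1 k ^ (2 * (n + 1))) with hG
    have hG0 : ∀ x, 0 ≤ G x := fun x => Finset.sum_nonneg fun k _ => by rw [pow_mul, pow_mul]; positivity
    have hs0 : ∀ x : PhaseSpace L, 0 ≤ ∑ k ∈ S, (x.2 k ^ 2 + x.1 k ^ 2) := fun x =>
      Finset.sum_nonneg fun k _ => by positivity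
    have hpt : ∀ x : PhaseSpace L, (1 + ∑ k ∈ S, (x.2 k ^ 2 + x.1 k ^ 2)) ^ (n + 1) ≤
        (2 : ℝ) ^ n + ((2 : ℝ) ^ n * ((5 : ℝ) ^ n * (2 : ℝ) ^ n)) * G x := by
      intro x
      have h1 := add_pow_le zero_le_one (hs0 x) (n + 1)
      rw [Nat.add_sub_cancel, one_pow] at h1
      have h2 := pow_sum_le_card_mul_sum_pow (s := S) (f := fun k : Fin L => x.2 k ^ 2 + x.1 k ^ 2)
        (fun k _ => by positivity) n
      have h3 : ∀ k : Fin L, (x.2 k ^ 2 + x.1 k ^ 2) ^ (n + 1) ≤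
          2 ^ n * (x.2 k ^ (2 * (n + 1)) + x.1 k ^ (2 * (n + 1))) := by
        intro k
        have h := add_pow_le (sq_nonneg (x.2 k)) (sq_nonneg (x.1 k)) (n + 1)
        rw [Nat.add_sub_cancel, ← pow_mul, ← pow_mul] at h
        exact h
      have h4 : ∑ k ∈ S, (x.2 k ^ 2 + x.1 k ^ 2) ^ (n + 1) ≤ 2 ^ n * G x := by
        rw [hG]
        dsimp only
        rw [Finset.mul_sum]
        exact Finset.sum_le_sum fun k _ => h3 k
      have h5 : (S.card : ℝ) ^ n ≤ 5 ^ n := pow_le_pow_left₀ (Nat.cast_nonneg _) hcard n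
      have h6 : (∑ k ∈ S, (x.2 k ^ 2 + x.1 k ^ 2)) ^ (n + 1) ≤ 5 ^ n * (2 ^ n * G x) :=
        h2.trans (mul_le_mul h5 h4 (Finset.sum_nonneg fun k _ => by positivity) (by positivity))
      calc (1 + ∑ k ∈ S, (x.2 k ^ 2 + x.1 k ^ 2)) ^ (n + 1)
          ≤ 2 ^ n * (1 + (∑ k ∈ S, (x.2 k ^ 2 + x.1 k ^ 2)) ^ (n + 1)) := h1
        _ ≤ 2 ^ n * (1 + 5 ^ n * (2 ^ n * G x)) := by gcongr
        _ = _ := by ring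
    have hIp : ∀ k : Fin L, Integrable (fun x : PhaseSpace L => x.2 k ^ (2 * (n + 1)))
        ((pinnedChain ω₂ lam β γ).gibbsMeasure L T) := fun k => integrable_snd_pow hω hl hβ γ hT L k _
    have hIq : ∀ k : Fin L, Integrable (fun x : PhaseSpace L => x.1 k ^ (2 * (n + 1)))
        ((pinnedChain ω₂ lam β γ).gibbsMeasure L T) := fun k => integrable_fst_pow hω hl hβ γ hT L k _
    have hIpq : ∀ k : Fin L, Integrable (fun x : PhaseSpace L => x.2 k ^ (2 * (n + 1)) + x.1 k ^ (2 * (n + 1)))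
        ((pinnedChain ω₂ lam β γ).gibbsMeasure L T) := fun k => (hIp k).add (hIq k)
    have hGi : Integrable G ((pinnedChain ω₂ lam β γ).gibbsMeasure L T) :=
      integrable_finsetSum _ fun k _ => hIpq k
    have hGle : ∫ x, G x ∂((pinnedChain ω₂ lam β γ).gibbsMeasure L T) ≤ 5 * (Cp + Cq) := by
      rw [hG]
      dsimp only
      rw [integral_finsetSum _ fun k _ => hIpq k]
      have hk : ∀ k ∈ S, ∫ x, (x.2 k ^ (2 * (n + 1)) + x.1 k ^ (2 * (n + 1))) ∂((pinnedChain ω₂ lam β γ).gibbsMeasure L T) ≤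
          Cp + Cq := by
        intro k _
        rw [integral_add (hIp k) (hIq k)]
        exact add_le_add (integral_snd_even_pow_le hω hl hβ γ hT L k (n + 1)) (hCq L k)
      calc ∑ k ∈ S, ∫ x, (x.2 k ^ (2 * (n + 1)) + x.1 k ^ (2 * (n + 1))) ∂((pinnedChain ω₂ lam β γ).gibbsMeasure L T)
          ≤ ∑ k ∈ S, (Cp + Cq) := Finset.sum_le_sum hk
        _ = S.card * (Cp + Cq) := by rw [Finset.sum_const, nsmul_eq_mul]
        _ ≤ 5 * (Cp + Cq) := mul_le_mul_of_nonneg_right hcard (by positivity)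
    calc ∫ x, (1 + ∑ k ∈ S, (x.2 k ^ 2 + x.1 k ^ 2)) ^ (n + 1) ∂((pinnedChain ω₂ lam β γ).gibbsMeasure L T)
        ≤ ∫ x, ((2 : ℝ) ^ n + ((2 : ℝ) ^ n * ((5 : ℝ) ^ n * (2 : ℝ) ^ n)) * G x) ∂((pinnedChain ω₂ lam β γ).gibbsMeasure L T) :=
          integral_mono (hint _ L c) ((integrable_const _).add (hGi.const_mul _)) hpt
      _ = (2 : ℝ) ^ n + ((2 : ℝ) ^ n * ((5 : ℝ) ^ n * (2 : ℝ) ^ n)) * ∫ x, G x ∂((pinnedChain ω₂ lam β γ).gibbsMeasure L T) := by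
          rw [integral_add (integrable_const _) (hGi.const_mul _), integral_const_mul]
          simp
      _ ≤ (2 : ℝ) ^ n + ((2 : ℝ) ^ n * ((5 : ℝ) ^ n * (2 : ℝ) ^ n)) * (5 * (Cp + Cq)) := by gcongr

end Gibbs

/-! ### The bond blocks `R_A`, `R_B`: dependence on the momenta, smoothness -/

/-- `R_A^{(i,j)}` depends on `x` only through the positions and the momenta `p_j`, `p_{j+1}`. [folklore] -/
theorem bondRA_congr (i j : Fin L) {x y : PhaseSpace L} (h1 : y.1 = x.1) (hj : y.2 j = x.2 j)
    (hs : ∀ k : Fin L, k.val = j.val + 1 → y.2 k = x.2 k) :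
    (y.2 j * (y.2 j ^ 2 * (6 * β * (9 * β * (y.1 j - y.1 i) ^ 2 - 1) / (1 + 3 * β * (y.1 j - y.1 i) ^ 2) ^ 3) - partialQ j (partialQ j ((pinnedChain ω₂ lam β γ).hamiltonian L)) y * (1 / (1 + 3 * β * (y.1 j - y.1 i) ^ 2)) - 3 * partialQ j ((pinnedChain ω₂ lam β γ).hamiltonian L) y * (-(6 * β * (y.1 j - y.1 i)) / (1 + 3 * β * (y.1 j - y.1 i) ^ 2) ^ 2)) + (∑ k : Fin L, if k.val = j.val + 1 then y.2 k * (1 + 3 * β * (y.1 k - y.1 j) ^ 2) else 0) * (1 / (1 + 3 * β * (y.1 j - y.1 i) ^ 2))) =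
      (x.2 j * (x.2 j ^ 2 * (6 * β * (9 * β * (x.1 j - x.1 i) ^ 2 - 1) / (1 + 3 * β * (x.1 j - x.1 i) ^ 2) ^ 3) - partialQ j (partialQ j ((pinnedChain ω₂ lam β γ).hamiltonian L)) x * (1 / (1 + 3 * β * (x.1 j - x.1 i) ^ 2)) - 3 * partialQ j ((pinnedChain ω₂ lam β γ).hamiltonian L) x * (-(6 * β * (x.1 j - x.1 i)) / (1 + 3 * β * (x.1 j - x.1 i) ^ 2) ^ 2)) + (∑ k : Fin L, if k.val = j.val + 1 then x.2 k * (1 + 3 * β * (x.1 k - x.1 j) ^ 2) else 0) * (1 / (1 + 3 * β * (x.1 j - x.1 i) ^ 2))) := by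
  have hsum : (∑ k : Fin L, if k.val = j.val + 1 then y.2 k * (1 + 3 * β * (y.1 k - y.1 j) ^ 2) else 0) =
      (∑ k : Fin L, if k.val = j.val + 1 then x.2 k * (1 + 3 * β * (x.1 k - x.1 j) ^ 2) else 0) := by
    refine Finset.sum_congr rfl fun k _ => ?_
    split_ifs with hk
    · rw [hs k hk, h1]
    · rfl
  rw [hsum, partialQ_partialQ_hamiltonian, partialQ_partialQ_hamiltonian, partialQ_hamiltonian, partialQ_hamiltonian,
    h1, hj]

/-- `R_B^{(i,j)}` depends on `x` only through the positions and the momenta `p_i`, `p_{i−1}`. [folklore] -/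
theorem bondRB_congr (i j : Fin L) {x y : PhaseSpace L} (h1 : y.1 = x.1) (hi : y.2 i = x.2 i)
    (hs : ∀ k : Fin L, i.val = k.val + 1 → y.2 k = x.2 k) :
    (y.2 i * (-(y.2 i ^ 2 * (6 * β * (9 * β * (y.1 j - y.1 i) ^ 2 - 1) / (1 + 3 * β * (y.1 j - y.1 i) ^ 2) ^ 3)) + partialQ i (partialQ i ((pinnedChain ω₂ lam β γ).hamiltonian L)) y * (1 / (1 + 3 * β * (y.1 j - y.1 i) ^ 2)) - 3 * partialQ i ((pinnedChain ω₂ lam β γ).hamiltonian L) y * (-(6 * β * (y.1 j - y.1 i)) / (1 + 3 * β * (y.1 j - y.1 i) ^ 2) ^ 2)) - (∑ k : Fin L, if i.val = k.val + 1 then y.2 k * (1 + 3 * β * (y.1 i - y.1 k) ^ 2) else 0) * (1 / (1 + 3 * β * (y.1 j - y.1 i) ^ 2))) =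
      (x.2 i * (-(x.2 i ^ 2 * (6 * β * (9 * β * (x.1 j - x.1 i) ^ 2 - 1) / (1 + 3 * β * (x.1 j - x.1 i) ^ 2) ^ 3)) + partialQ i (partialQ i ((pinnedChain ω₂ lam β γ).hamiltonian L)) x * (1 / (1 + 3 * β * (x.1 j - x.1 i) ^ 2)) - 3 * partialQ i ((pinnedChain ω₂ lam β γ).hamiltonian L) x * (-(6 * β * (x.1 j - x.1 i)) / (1 + 3 * β * (x.1 j - x.1 i) ^ 2) ^ 2)) - (∑ k : Fin L, if i.val = k.val + 1 then x.2 k * (1 + 3 * β * (x.1 i - x.1 k) ^ 2) else 0) * (1 / (1 + 3 * β * (x.1 j - x.1 i) ^ 2))) := by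
  have hsum : (∑ k : Fin L, if i.val = k.val + 1 then y.2 k * (1 + 3 * β * (y.1 i - y.1 k) ^ 2) else 0) =
      (∑ k : Fin L, if i.val = k.val + 1 then x.2 k * (1 + 3 * β * (x.1 i - x.1 k) ^ 2) else 0) := by
    refine Finset.sum_congr rfl fun k _ => ?_
    split_ifs with hk
    · rw [hs k hk, h1]
    · rfl
  rw [hsum, partialQ_partialQ_hamiltonian, partialQ_partialQ_hamiltonian, partialQ_hamiltonian, partialQ_hamiltonian,
    h1, hi]

/-- The atoms are smooth: `p_k`, `∂_{q_k} H`, `∂_{q_k}∂_{q_k} H`. [folklore] -/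
theorem contDiff_partialQ_partialQ_hamiltonian (k : Fin L) :
    ContDiff ℝ ∞ fun x : PhaseSpace L => partialQ k (partialQ k ((pinnedChain ω₂ lam β γ).hamiltonian L)) x :=
  contDiff_partialQ (contDiff_partialQ_hamiltonian k) (by simp) k

/-- The boundary sum `Σ_{k = j+1} p_k V''(q_k − q_j)` is smooth. [folklore] -/
theorem contDiff_sumA (j : Fin L) :
    ContDiff ℝ ∞ fun x : PhaseSpace L => (∑ k : Fin L, if k.val = j.val + 1 then x.2 k * (1 + 3 * β * (x.1 k - x.1 j) ^ 2) else 0) := by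
  refine ContDiff.sum fun k _ => ?_
  by_cases hk : k.val = j.val + 1
  · simp only [if_pos hk]
    exact (contDiff_snd_apply k).mul (contDiff_const.add (contDiff_const.mul
      (((contDiff_fst_apply k).sub (contDiff_fst_apply j)).pow 2)))
  · simp only [if_neg hk]
    exact contDiff_const

/-- The boundary sum `Σ_{i = k+1} p_k V''(q_i − q_k)` is smooth. [folklore] -/
theorem contDiff_sumB (i : Fin L) :
    ContDiff ℝ ∞ fun x : PhaseSpace L => (∑ k : Fin L, if i.val = k.val + 1 then x.2 k * (1 + 3 * β * (x.1 i - x.1 k) ^ 2) else 0) := by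
  refine ContDiff.sum fun k _ => ?_
  by_cases hk : i.val = k.val + 1
  · simp only [if_pos hk]
    exact (contDiff_snd_apply k).mul (contDiff_const.add (contDiff_const.mul
      (((contDiff_fst_apply i).sub (contDiff_fst_apply k)).pow 2)))
  · simp only [if_neg hk]
    exact contDiff_const

/-- `R_A^{(i,j)}` is smooth (`β ≥ 0`). [folklore] -/
theorem contDiff_bondRA (hβ : 0 ≤ β) (i j : Fin L) :
    ContDiff ℝ ∞ fun x : PhaseSpace L => (x.2 j * (x.2 j ^ 2 * (6 * β * (9 * β * (x.1 j - x.1 i) ^ 2 - 1) / (1 + 3 * β * (x.1 j - x.1 i) ^ 2) ^ 3) - partialQ j (partialQ j ((pinnedChain ω₂ lam β γ).hamiltonian L)) x * (1 / (1 + 3 * β * (x.1 j - x.1 i) ^ 2)) - 3 * partialQ j ((pinnedChain ω₂ lam β γ).hamiltonian L) x * (-(6 * β * (x.1 j - x.1 i)) / (1 + 3 * β * (x.1 j - x.1 i) ^ 2) ^ 2)) + (∑ k : Fin L, if k.val = j.val + 1 then x.2 k * (1 + 3 * β * (x.1 k - x.1 j) ^ 2) else 0) * (1 / (1 + 3 *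 β * (x.1 j - x.1 i) ^ 2))) :=
  ((contDiff_snd_apply j).mul (((((contDiff_snd_apply j).pow 2).mul (contDiff_ddphi_coord hβ i j)).sub
    ((contDiff_partialQ_partialQ_hamiltonian j).mul (contDiff_phi_coord hβ i j))).sub
    ((contDiff_const.mul (contDiff_partialQ_hamiltonian j)).mul (contDiff_dphi_coord hβ i j)))).add
    ((contDiff_sumA j).mul (contDiff_phi_coord hβ i j))

/-- `R_B^{(i,j)}` is smooth (`β ≥ 0`). [folklore] -/
theorem contDiff_bondRB (hβ : 0 ≤ β) (i j : Fin L) :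
    ContDiff ℝ ∞ fun x : PhaseSpace L => (x.2 i * (-(x.2 i ^ 2 * (6 * β * (9 * β * (x.1 j - x.1 i) ^ 2 - 1) / (1 + 3 * β * (x.1 j - x.1 i) ^ 2) ^ 3)) + partialQ i (partialQ i ((pinnedChain ω₂ lam β γ).hamiltonian L)) x * (1 / (1 + 3 * β * (x.1 j - x.1 i) ^ 2)) - 3 * partialQ i ((pinnedChain ω₂ lam β γ).hamiltonian L) x * (-(6 * β * (x.1 j - x.1 i)) / (1 + 3 * β * (x.1 j - x.1 i) ^ 2) ^ 2)) - (∑ k : Fin L, if i.val = k.val + 1 then x.2 k * (1 + 3 * β * (x.1 i - x.1 k) ^ 2) else 0) * (1 / (1 + 3 * β * (x.1 j - x.1 i) ^ 2))) :=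
  ((contDiff_snd_apply i).mul (((((contDiff_snd_apply i).pow 2).mul (contDiff_ddphi_coord hβ i j)).neg.add
    ((contDiff_partialQ_partialQ_hamiltonian i).mul (contDiff_phi_coord hβ i j))).sub
    ((contDiff_const.mul (contDiff_partialQ_hamiltonian i)).mul (contDiff_dphi_coord hβ i j)))).sub
    ((contDiff_sumB i).mul (contDiff_phi_coord hβ i j))

/-! ### The site-indexed bond functions `f^A_i = Σ_{j=i+1} p_i R_A`, `f^B_j = Σ_{j=i+1} p_j R_B` -/

/-- `f^A_i` is continuous (`β ≥ 0`). [folklore] -/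
theorem continuous_fA (hβ : 0 ≤ β) (i : Fin L) :
    Continuous fun x : PhaseSpace L => (∑ j : Fin L, if j.val = i.val + 1 then x.2 i * (x.2 j * (x.2 j ^ 2 * (6 * β * (9 * β * (x.1 j - x.1 i) ^ 2 - 1) / (1 + 3 * β * (x.1 j - x.1 i) ^ 2) ^ 3) - partialQ j (partialQ j ((pinnedChain ω₂ lam β γ).hamiltonian L)) x * (1 / (1 + 3 * β * (x.1 j - x.1 i) ^ 2)) - 3 * partialQ j ((pinnedChain ω₂ lam β γ).hamiltonian L) x * (-(6 * β * (x.1 j - x.1 i)) / (1 + 3 * β * (x.1 j - x.1 i) ^ 2) ^ 2)) + (∑ k : Fin L, if k.val = j.val + 1 then x.2 k * (1 + 3 * β * (x.1 k - x.1 j) ^ 2) else 0) * (1 / (1 + 3 * β * (x.1 j - x.1 i) ^ 2))) else 0) := by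
  refine continuous_finsetSum _ fun j _ => ?_
  by_cases hj : j.val = i.val + 1
  · simp only [if_pos hj]
    exact ((contDiff_snd_apply i).mul (contDiff_bondRA hβ i j)).continuous
  · simp only [if_neg hj]
    exact continuous_const

/-- `f^B_j` is continuous (`β ≥ 0`). [folklore] -/
theorem continuous_fB (hβ : 0 ≤ β) (j : Fin L) :
    Continuous fun x : PhaseSpace L => (∑ i : Fin L, if j.val = i.val + 1 then x.2 j * (x.2 i * (-(x.2 i ^ 2 * (6 * β * (9 * β * (x.1 j - x.1 i) ^ 2 - 1) / (1 + 3 * β * (x.1 j - x.1 i) ^ 2) ^ 3)) + partialQ i (partialQ i ((pinnedChain ω₂ lam β γ).hamiltonian L)) x * (1 / (1 + 3 * β * (x.1 j - x.1 i) ^ 2)) - 3 * partialQ i ((pinnedChain ω₂ lam β γ).hamiltonian L) x * (-(6 * β * (x.1 j - x.1 i)) / (1 + 3 * β * (x.1 j - x.1 i) ^ 2) ^ 2)) - (∑ k : Fin L, if i.val = k.val + 1 then x.2 k * (1 + 3 * β * (x.1 i - x.1 k) ^ 2) else 0) * (1 / (1 + 3 * β * (x.1 j - x.1 i) ^ 2)))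 else 0) := by
  refine continuous_finsetSum _ fun i _ => ?_
  by_cases hj : j.val = i.val + 1
  · simp only [if_pos hj]
    exact ((contDiff_snd_apply j).mul (contDiff_bondRB hβ i j)).continuous
  · simp only [if_neg hj]
    exact continuous_const

/-- **`(f^A_i)² ≤ K m_i⁵`** with the local size `m_i` of the window around `i` and `K = K(ω₂, lam, β)`. [folklore] -/
theorem fA_sq_le (ω₂ lam γ : ℝ) (hβ : 0 ≤ β) : ∃ K : ℝ, 0 ≤ K ∧ ∀ (L : ℕ) (i : Fin L) (x : PhaseSpace L),
    (∑ j : Fin L, if j.val = i.val + 1 then x.2 i * (x.2 j * (x.2 j ^ 2 * (6 * β * (9 * β * (x.1 j - x.1 i) ^ 2 - 1) / (1 + 3 * β * (x.1 j - x.1 i) ^ 2) ^ 3) - partialQ j (partialQ j ((pinnedChain ω₂ lam β γ).hamiltonian L)) x * (1 / (1 + 3 * β * (x.1 j - x.1 i) ^ 2)) - 3 * partialQ j ((pinnedChain ω₂ lam β γ).hamiltonian L) x * (-(6 * β * (x.1 j - x.1 i)) / (1 + 3 * β * (x.1 j - x.1 i) ^ 2) ^ 2)) + (∑ k : Fin L,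 if k.val = j.val + 1 then x.2 k * (1 + 3 * β * (x.1 k - x.1 j) ^ 2) else 0) * (1 / (1 + 3 * β * (x.1 j - x.1 i) ^ 2))) else 0) ^ 2 ≤
      K * (1 + ∑ k ∈ Finset.univ.filter (fun k : Fin L => i.val ≤ k.val + 2 ∧ k.val ≤ i.val + 2), (x.2 k ^ 2 + x.1 k ^ 2)) ^ 5 := by
  obtain ⟨KA, hKA0, hKA⟩ := bondRA_sq_le ω₂ lam γ hβ
  refine ⟨1 * KA, by positivity, fun L i x => ?_⟩
  have hm := one_le_localSize i x
  refine sq_sum_succ_le i (by positivity) fun j hj => sq_lift (sq_mul_le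
    (sq_le_pow_one (sq_le_localSize (c := i) (k := i) ⟨by omega, by omega⟩ x).1)
    (hKA L i j x _ hm (sq_le_localSize (c := i) (k := j) ⟨by omega, by omega⟩ x).1
      (sq_le_localSize (c := i) (k := j) ⟨by omega, by omega⟩ x).2
      (fun l hl => (sq_le_localSize (c := i) (k := l) ⟨by omega, by omega⟩ x).1)
      (fun l hl => (sq_le_localSize (c := i) (k := l) ⟨by omega, by omega⟩ x).2)
      (fun l hl => (sq_le_localSize (c := i) (k := l) ⟨by omega, by omega⟩ x).2))) hm (by norm_num)

/-- **`(f^B_j)² ≤ K m_j⁵`** with the local size `m_j` of the window around `j` and `K = K(ω₂, lam, β)`. [folklore] -/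
theorem fB_sq_le (ω₂ lam γ : ℝ) (hβ : 0 ≤ β) : ∃ K : ℝ, 0 ≤ K ∧ ∀ (L : ℕ) (j : Fin L) (x : PhaseSpace L),
    (∑ i : Fin L, if j.val = i.val + 1 then x.2 j * (x.2 i * (-(x.2 i ^ 2 * (6 * β * (9 * β * (x.1 j - x.1 i) ^ 2 - 1) / (1 + 3 * β * (x.1 j - x.1 i) ^ 2) ^ 3)) + partialQ i (partialQ i ((pinnedChain ω₂ lam β γ).hamiltonian L)) x * (1 / (1 + 3 * β * (x.1 j - x.1 i) ^ 2)) - 3 * partialQ i ((pinnedChain ω₂ lam β γ).hamiltonian L) x * (-(6 * β * (x.1 j - x.1 i)) / (1 + 3 * β * (x.1 j - x.1 i) ^ 2) ^ 2)) - (∑ k : Fin L, if i.val = k.val + 1 then x.2 k * (1 + 3 * β * (x.1 i - x.1 k) ^ 2) else 0) * (1 / (1 + 3 * β * (x.1 j - x.1 i) ^ 2))) else 0) ^ 2 ≤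
      K * (1 + ∑ k ∈ Finset.univ.filter (fun k : Fin L => j.val ≤ k.val + 2 ∧ k.val ≤ j.val + 2), (x.2 k ^ 2 + x.1 k ^ 2)) ^ 5 := by
  obtain ⟨KB, hKB0, hKB⟩ := bondRB_sq_le ω₂ lam γ hβ
  refine ⟨1 * KB, by positivity, fun L j x => ?_⟩
  have hm := one_le_localSize j x
  refine sq_sum_pred_le j (by positivity) fun i hj => sq_lift (sq_mul_le
    (sq_le_pow_one (sq_le_localSize (c := j) (k := j) ⟨by omega, by omega⟩ x).1)
    (hKB L i j x _ hm (sq_le_localSize (c := j) (k := i) ⟨by omega, by omega⟩ x).1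
      (sq_le_localSize (c := j) (k := i) ⟨by omega, by omega⟩ x).2
      (fun l hl => (sq_le_localSize (c := j) (k := l) ⟨by omega, by omega⟩ x).1)
      (fun l hl => (sq_le_localSize (c := j) (k := l) ⟨by omega, by omega⟩ x).2)
      (fun l hl => (sq_le_localSize (c := j) (k := l) ⟨by omega, by omega⟩ x).2))) hm (by norm_num)

/-! ### Momentum-flip parities of `f^A_i`, `f^B_j` -/

/-- `f^A_i` is EVEN under `F_m` for `m ∉ {i, i+1, i+2}` (it involves the momenta `p_i, p_{i+1}, p_{i+2}` only).
[folklore] -/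
theorem fA_momentumFlip_of_ne {i m : Fin L} (h0 : m ≠ i) (h1 : m.val ≠ i.val + 1) (h2 : m.val ≠ i.val + 2)
    (x : PhaseSpace L) :
    (∑ j : Fin L, if j.val = i.val + 1 then (momentumFlip m x).2 i * ((momentumFlip m x).2 j * ((momentumFlip m x).2 j ^ 2 * (6 * β * (9 * β * ((momentumFlip m x).1 j - (momentumFlip m x).1 i) ^ 2 - 1) / (1 + 3 * β * ((momentumFlip m x).1 j - (momentumFlip m x).1 i) ^ 2) ^ 3) - partialQ j (partialQ j ((pinnedChain ω₂ lam β γ).hamiltonian L)) (momentumFlip m x) * (1 / (1 + 3 * β * ((momentumFlip m x).1 j - (momentumFlip m x).1 i) ^ 2)) - 3 * partialQ j ((pinnedChain ω₂ lam β γ).hamiltonian L) (momentumFlip m x) * (-(6 * β * ((momentumFlip m x).1 j - (momentumFlip m x).1 i)) / (1 + 3 * β * ((momentumFlip m x).1 j - (momentumFlip m x).1 i) ^ 2) ^ 2)) + (∑ k : Fin L, if k.val = j.val + 1 then (momentumFlip m x).2 k * (1 + 3 * β * ((momentumFlip m x).1 k - (momentumFlip m x).1 j) ^ 2) else 0) *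 (1 / (1 + 3 * β * ((momentumFlip m x).1 j - (momentumFlip m x).1 i) ^ 2))) else 0) =
      (∑ j : Fin L, if j.val = i.val + 1 then x.2 i * (x.2 j * (x.2 j ^ 2 * (6 * β * (9 * β * (x.1 j - x.1 i) ^ 2 - 1) / (1 + 3 * β * (x.1 j - x.1 i) ^ 2) ^ 3) - partialQ j (partialQ j ((pinnedChain ω₂ lam β γ).hamiltonian L)) x * (1 / (1 + 3 * β * (x.1 j - x.1 i) ^ 2)) - 3 * partialQ j ((pinnedChain ω₂ lam β γ).hamiltonian L) x * (-(6 * β * (x.1 j - x.1 i)) / (1 + 3 * β * (x.1 j - x.1 i) ^ 2) ^ 2)) + (∑ k : Fin L, if k.val = j.val + 1 then x.2 k * (1 + 3 * β * (x.1 k - x.1 j) ^ 2) else 0) * (1 / (1 + 3 * β * (x.1 j - x.1 i) ^ 2))) else 0) := by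
  refine Finset.sum_congr rfl fun j _ => ?_
  split_ifs with hj
  · rw [momentumFlip_snd_of_ne (Ne.symm h0), bondRA_congr i j (momentumFlip_fst m x)
      (momentumFlip_snd_of_ne (show j ≠ m from fun e => h1 (by rw [← e]; exact hj)) x)
      (fun k hk => momentumFlip_snd_of_ne (show k ≠ m from fun e => h2 (by rw [← e]; omega)) x)]
  · rfl

/-- `f^A_i` is ODD under `F_i`. [folklore] -/
theorem fA_momentumFlip_self (i : Fin L) (x : PhaseSpace L) :
    (∑ j : Fin L, if j.val = i.val + 1 then (momentumFlip i x).2 i * ((momentumFlip i x).2 j * ((momentumFlip i x).2 j ^ 2 * (6 * β * (9 * β * ((momentumFlip i x).1 j - (momentumFlip i x).1 i) ^ 2 - 1) / (1 + 3 * β * ((momentumFlip i x).1 j - (momentumFlip i x).1 i) ^ 2) ^ 3) - partialQ j (partialQ j ((pinnedChain ω₂ lam β γ).hamiltonian L)) (momentumFlip i x) * (1 / (1 + 3 * β * ((momentumFlip i x).1 j - (momentumFlip i x).1 i) ^ 2)) - 3 * partialQ j ((pinnedChain ω₂ lam β γ).hamiltonian L) (momentumFlip i x) * (-(6 * β * ((momentumFlip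 i x).1 j - (momentumFlip i x).1 i)) / (1 + 3 * β * ((momentumFlip i x).1 j - (momentumFlip i x).1 i) ^ 2) ^ 2)) + (∑ k : Fin L, if k.val = j.val + 1 then (momentumFlip i x).2 k * (1 + 3 * β * ((momentumFlip i x).1 k - (momentumFlip i x).1 j) ^ 2) else 0) * (1 / (1 + 3 * β * ((momentumFlip i x).1 j - (momentumFlip i x).1 i) ^ 2))) else 0) =
      -(∑ j : Fin L, if j.val = i.val + 1 then x.2 i * (x.2 j * (x.2 j ^ 2 * (6 * β * (9 * β * (x.1 j - x.1 i) ^ 2 - 1) / (1 + 3 * β * (x.1 j - x.1 i) ^ 2) ^ 3) - partialQ j (partialQ j ((pinnedChain ω₂ lam β γ).hamiltonian L)) x * (1 / (1 + 3 * β * (x.1 j - x.1 i) ^ 2)) - 3 * partialQ j ((pinnedChain ω₂ lam β γ).hamiltonian L) x * (-(6 * β * (x.1 j - x.1 i)) / (1 + 3 * β * (x.1 j - x.1 i) ^ 2) ^ 2)) + (∑ k : Fin L, if k.val = j.val + 1 then x.2 k * (1 + 3 * β * (x.1 k - x.1 j) ^ 2) else 0) * (1 / (1 + 3 * β * (x.1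 j - x.1 i) ^ 2))) else 0) := by
  rw [← Finset.sum_neg_distrib]
  refine Finset.sum_congr rfl fun j _ => ?_
  split_ifs with hj
  · rw [momentumFlip_snd_self, bondRA_congr i j (momentumFlip_fst i x)
      (momentumFlip_snd_of_ne (show j ≠ i from fun e => by rw [e] at hj; omega) x)
      (fun k hk => momentumFlip_snd_of_ne (show k ≠ i from fun e => by rw [e] at hk; omega) x), neg_mul]
  · exact neg_zero.symm

/-- `f^B_j` is EVEN under `F_m` for `m ∉ {j, j−1, j−2}` (it involves the momenta `p_j, p_{j−1}, p_{j−2}` only).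
[folklore] -/
theorem fB_momentumFlip_of_ne {j m : Fin L} (h0 : m ≠ j) (h1 : m.val + 1 ≠ j.val) (h2 : m.val + 2 ≠ j.val)
    (x : PhaseSpace L) :
    (∑ i : Fin L, if j.val = i.val + 1 then (momentumFlip m x).2 j * ((momentumFlip m x).2 i * (-((momentumFlip m x).2 i ^ 2 * (6 * β * (9 * β * ((momentumFlip m x).1 j - (momentumFlip m x).1 i) ^ 2 - 1) / (1 + 3 * β * ((momentumFlip m x).1 j - (momentumFlip m x).1 i) ^ 2) ^ 3)) + partialQ i (partialQ i ((pinnedChain ω₂ lam β γ).hamiltonian L)) (momentumFlip m x) * (1 / (1 + 3 * β * ((momentumFlip m x).1 j - (momentumFlip m x).1 i) ^ 2)) - 3 * partialQ i ((pinnedChain ω₂ lam β γ).hamiltonian L) (momentumFlip m x) * (-(6 * β * ((momentumFlip m x).1 j - (momentumFlip m x).1 i)) / (1 + 3 * β * ((momentumFlip m x).1 j - (momentumFlip m x).1 i) ^ 2) ^ 2)) - (∑ k : Fin L, if i.val = k.val + 1 then (momentumFlip m x).2 k * (1 + 3 * β * ((momentumFlip m x).1 i - (momentumFlip m x).1 k)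 ^ 2) else 0) * (1 / (1 + 3 * β * ((momentumFlip m x).1 j - (momentumFlip m x).1 i) ^ 2))) else 0) =
      (∑ i : Fin L, if j.val = i.val + 1 then x.2 j * (x.2 i * (-(x.2 i ^ 2 * (6 * β * (9 * β * (x.1 j - x.1 i) ^ 2 - 1) / (1 + 3 * β * (x.1 j - x.1 i) ^ 2) ^ 3)) + partialQ i (partialQ i ((pinnedChain ω₂ lam β γ).hamiltonian L)) x * (1 / (1 + 3 * β * (x.1 j - x.1 i) ^ 2)) - 3 * partialQ i ((pinnedChain ω₂ lam β γ).hamiltonian L) x * (-(6 * β * (x.1 j - x.1 i)) / (1 + 3 * β * (x.1 j - x.1 i) ^ 2) ^ 2)) - (∑ k : Fin L, if i.val = k.val + 1 then x.2 k * (1 + 3 * β * (x.1 i - x.1 k) ^ 2) else 0) * (1 / (1 + 3 * β * (x.1 j - x.1 i) ^ 2))) else 0) := by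
  refine Finset.sum_congr rfl fun i _ => ?_
  split_ifs with hj
  · rw [momentumFlip_snd_of_ne (Ne.symm h0), bondRB_congr i j (momentumFlip_fst m x)
      (momentumFlip_snd_of_ne (show i ≠ m from fun e => h1 (by rw [← e]; omega)) x)
      (fun k hk => momentumFlip_snd_of_ne (show k ≠ m from fun e => h2 (by rw [← e]; omega)) x)]
  · rfl

/-- `f^B_j` is ODD under `F_j`. [folklore] -/
theorem fB_momentumFlip_self (j : Fin L) (x : PhaseSpace L) :
    (∑ i : Fin L, if j.val = i.val + 1 then (momentumFlip j x).2 j * ((momentumFlip j x).2 i * (-((momentumFlip j x).2 i ^ 2 * (6 * β * (9 * β * ((momentumFlip j x).1 j - (momentumFlip j x).1 i) ^ 2 - 1) / (1 + 3 * β * ((momentumFlip j x).1 j - (momentumFlip j x).1 i) ^ 2) ^ 3)) + partialQ i (partialQ i ((pinnedChain ω₂ lam β γ).hamiltonian L)) (momentumFlip j x) * (1 / (1 + 3 * β * ((momentumFlip j x).1 j - (momentumFlip j x).1 i) ^ 2)) - 3 * partialQ i ((pinnedChain ω₂ lam β γ).hamiltonian L) (momentumFlip j x) * (-(6 * β * ((momentumFlip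 j x).1 j - (momentumFlip j x).1 i)) / (1 + 3 * β * ((momentumFlip j x).1 j - (momentumFlip j x).1 i) ^ 2) ^ 2)) - (∑ k : Fin L, if i.val = k.val + 1 then (momentumFlip j x).2 k * (1 + 3 * β * ((momentumFlip j x).1 i - (momentumFlip j x).1 k) ^ 2) else 0) * (1 / (1 + 3 * β * ((momentumFlip j x).1 j - (momentumFlip j x).1 i) ^ 2))) else 0) =
      -(∑ i : Fin L, if j.val = i.val + 1 then x.2 j * (x.2 i * (-(x.2 i ^ 2 * (6 * β * (9 * β * (x.1 j - x.1 i) ^ 2 - 1) / (1 + 3 * β * (x.1 j - x.1 i) ^ 2) ^ 3)) + partialQ i (partialQ i ((pinnedChain ω₂ lam β γ).hamiltonian L)) x * (1 / (1 + 3 * β * (x.1 j - x.1 i) ^ 2)) - 3 * partialQ i ((pinnedChain ω₂ lam β γ).hamiltonian L) x * (-(6 * β * (x.1 j - x.1 i)) / (1 + 3 * β * (x.1 j - x.1 i) ^ 2) ^ 2)) - (∑ k : Fin L, if i.val = k.val + 1 then x.2 k * (1 + 3 * β * (x.1 i - x.1 k) ^ 2) else 0) * (1 / (1 + 3 * β *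 (x.1 j - x.1 i) ^ 2))) else 0) := by
  rw [← Finset.sum_neg_distrib]
  refine Finset.sum_congr rfl fun i _ => ?_
  split_ifs with hj
  · rw [momentumFlip_snd_self, bondRB_congr i j (momentumFlip_fst j x)
      (momentumFlip_snd_of_ne (show i ≠ j from fun e => by rw [e] at hj; omega) x)
      (fun k hk => momentumFlip_snd_of_ne (show k ≠ j from fun e => by rw [e] at hk; omega) x), neg_mul]
  · exact neg_zero.symm

/-! ### Registered helper -/

/-- Registered helper sub-goal `helper_thomsonWitnessLocalSizeMoments` of crux stmt-AtomisticToContinuum-11977 (line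
`abel-storage-decay`, stub B `stub_bulkAbelGKPositivity`, part W5b): `L`-uniform moments of the local size of a
five-site window under the Gibbs measure (`exists_integral_localSize_pow_le`, restated notation-free). [folklore] -/
theorem helper_thomsonWitnessLocalSizeMoments : ∀ (ω₂ lam β γ T : ℝ), 0 < ω₂ → 0 ≤ lam → 0 ≤ β → 0 < T → ∀ (n : ℕ), ∃ C : ℝ, ∀ (L : ℕ) (c : Fin L), MeasureTheory.Integrable (fun x : Literature.MathematicalPhysics.KineticTheory.HeatConduction.PhaseSpace L => (1 + ∑ k ∈ Finset.univ.filter (fun k : Fin L => c.val ≤ k.val + 2 ∧ k.val ≤ c.val + 2), (x.2 k ^ 2 + x.1 k ^ 2)) ^ n) ((Literature.MathematicalPhysics.KineticTheory.HeatConduction.pinnedChain ω₂ lam β γ).gibbsMeasure L T) ∧ MeasureTheory.integral ((Literature.MathematicalPhysics.KineticTheory.HeatConduction.pinnedChain ω₂ lam β γ).gibbsMeasure L T) (fun x => (1 + ∑ k ∈ Finset.univ.filter (fun k : Fin L => c.val ≤ k.val + 2 ∧ k.val ≤ c.val + 2), (x.2 k ^ 2 + x.1 k ^ 2)) ^ n)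 ≤ C :=
  fun _ _ _ γ _ hω hl hβ hT n => exists_integral_localSize_pow_le hω hl hβ γ hT n

end Summit.AtomisticToContinuum.FouriersLaw.Theorems.NoisyFourier.ThomsonWitness.Costs.Xv

end
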